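import Literature.Barriers.CriticalPhenomena.LaceExpansionGaussianIntegrals
import Literature.Barriers.CriticalPhenomena.LaceExpansionGaussianLemmaAssembly
import HarnessLib

/-!
# Hara 2008, Lemma 2.2 (large `t`), quantitative form: `Hara2008_lem22` proved

Barrier catalogue `Literature/Barriers/CriticalPhenomena/` (D-0021). DISCHARGES the named fact
`Hara2008_lem22` of `LaceExpansionGaussianLemmaAssembly.lean` — Hara 2008, Lemma 2.2 with the error
bound of §2.6: for `t ≥ 1` and all `x ∈ ℤ^d`,
`|I_t(x) - (d/(2πK₁t))^{d/2} e^{-d|x|²/(2tK₁)}| ≤ c t^{-(d+ρ∧2)/2}` under `HaraKernelHyp d J ρ`,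
`d ≥ 3` — by the printed proof: with `k_t = t^{-1/(2+ρ')}` (`ρ' = ρ∧2`),
`(2π)^d I_t(x) - ∫_{ℝ^d} e^{ik·x} e^{-tK₁|k|²/(2d)} dk = I₃ + I₄ - (-I₂)` where

* `I₃ = ∫_{|k|≤k_t} e^{ik·x}(e^{-t(1-Ĵ(k))} - e^{-tK₁|k|²/(2d)})` is bounded pointwise by
  `t|R̂₂(k)| e^{-tK₀|k|²/(2d)}` (`1 - Ĵ ≥ K₀|k|²/(2d)` on the cube, `K₀ ≤ K₁`,
  `|R̂₂(k)| ≤ (5/2)K₂'|k|^{2+ρ'}` from `LaceExpansionKernelTaylor.lean`), whose integral over `ℝ^d`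
  is `O(t · t^{-(d+2+ρ')/2})` (`lem22_inner_bound`, product Gaussian moments);
* `I₄ = ∫_{cube, |k|>k_t} e^{ik·x}e^{-t(1-Ĵ)}` and `-I₂ = ∫_{|k|>k_t} e^{ik·x}e^{-tK₁|k|²/(2d)}` are
  each at most `e^{-tK₀k_t²/(4d)} (4πd/(tK₀))^{d/2}` (`lem22_tail_bound`, (2.24)–(2.25)), and
  `t k_t² = t^{ρ'/(2+ρ')}` makes this `O(t^{-(d+ρ')/2})` (`exp_neg_cutoff_le`);

together with the exact Gaussian integral `I₁` (`integral_gaussian_eq_two_pi_pow_mul_gaussMain`).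
Objects: `lem22Phi` (the integrand of `(2π)^dI_t` with the real exponent `1 - Re Ĵ`, valid for
even `J`), `lem22Psi` (the Gaussian comparison integrand). Main theorem: `Hara2008_lem22_holds`.

After this file the trust base of `Hara2008_etaZeroXSpace` on the analytic side is the single
named fact `Hara2008_lem23` (Lemma 2.3: `d` integrations by parts).

## References

* T. Hara, Ann. Probab. 36 (2008) 530–593 (arXiv:math-ph/0504021): Lemma 2.2 and its proof
  ((2.19)–(2.25)), Lemma 2.1, §2.6 (the improved `R̂₂` and `R₃` bounds, `k_t = t^{-1/(2+ρ∧2)}`).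
-/

noncomputable section

namespace Literature.Barriers.CriticalPhenomena

open MeasureTheory Filter Finset Literature.Probability.LatticeModels Literature.Probability.Percolation
open scoped Topology BigOperators

variable {d : ℕ}

/-! ### Elementary pieces -/

/-- `|e^{-A} - e^{-B}| ≤ |A - B| e^{-m}` for `A, B ≥ m` (mean value bound for `u ↦ e^{-u}`).
[cite: Hara2008, proof of Lemma 2.2 (estimate of I_{t,3}, (2.21)–(2.22))] -/
theorem abs_exp_neg_sub_exp_neg_le {A B m : ℝ} (hA : m ≤ A) (hB : m ≤ B) :
    |Real.exp (-A) - Real.exp (-B)| ≤ |A - B| * Real.exp (-m) := by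
  -- reduce to `A ≤ B` by symmetry
  wlog hAB : A ≤ B generalizing A B
  · have h := this hB hA (le_of_not_ge hAB)
    rwa [abs_sub_comm, abs_sub_comm A B]
  have h1 : 0 ≤ Real.exp (-A) - Real.exp (-B) := by
    have := Real.exp_le_exp.2 (neg_le_neg hAB); linarith
  rw [abs_of_nonneg h1, abs_of_nonpos (by linarith : A - B ≤ 0)]
  -- `e^{-A} - e^{-B} = e^{-A}(1 - e^{-(B-A)}) ≤ e^{-A}(B - A) ≤ e^{-m}(B - A)`
  have h2 : 1 - Real.exp (-(B - A)) ≤ B - A := by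
    have := Real.add_one_le_exp (-(B - A)); linarith
  have h3 : Real.exp (-A) - Real.exp (-B) = Real.exp (-A) * (1 - Real.exp (-(B - A))) := by
    rw [mul_sub, mul_one, ← Real.exp_add]; congr 2; ring
  rw [h3]
  calc Real.exp (-A) * (1 - Real.exp (-(B - A))) ≤ Real.exp (-A) * (B - A) :=
        mul_le_mul_of_nonneg_left h2 (Real.exp_pos _).le
    _ ≤ Real.exp (-m) * (B - A) :=
        mul_le_mul_of_nonneg_right (Real.exp_le_exp.2 (neg_le_neg hA)) (by linarith)
    _ = -(A - B) * Real.exp (-m) := by ring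

/-- The cube `[-π,π]^d` has finite Lebesgue measure. [folklore] -/
theorem volume_cube_lt_top (d : ℕ) : volume (cube d) < ⊤ := by
  refine IsCompact.measure_lt_top ?_
  unfold cube
  exact isCompact_univ_pi fun _ => isCompact_Icc

/-- The small ball `{Σ_i k_i² ≤ κ²}` with `κ ≤ 1` lies in the cube `[-π,π]^d`. [folklore] -/
theorem mem_cube_of_sum_sq_le {k : Fin d → ℝ} {κ : ℝ} (hκ0 : 0 ≤ κ) (hκ : κ ≤ 1)
    (h : ∑ i, k i ^ 2 ≤ κ ^ 2) : k ∈ cube d := by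
  intro i _
  have hi : k i ^ 2 ≤ 1 := by
    have h1 : k i ^ 2 ≤ ∑ j, k j ^ 2 := Finset.single_le_sum (fun j _ => sq_nonneg (k j)) (Finset.mem_univ i)
    have h2 : κ ^ 2 ≤ 1 := by nlinarith
    linarith
  have habs : |k i| ≤ 1 := by
    rw [← sq_le_one_iff_abs_le_one]; exact hi
  rw [Set.mem_Icc]
  constructor <;> linarith [(abs_le.1 habs).1, (abs_le.1 habs).2, Real.pi_gt_three]

/-! ### The integrands -/

/-- For an even absolutely summable kernel, Hara's integrand has modulus `e^{-t(1 - Re Ĵ(k))}`: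
`e^{ik·x} e^{-t(1-Ĵ(k))} = e^{ik·x} · (e^{-t(1 - Re Ĵ(k))} : ℝ)`. [folklore] -/
theorem haraI_integrand_eq {J : Site d → ℝ} (hJ : Summable fun x => |J x|) (hJe : ∀ x, J (-x) = J x)
    (t : ℝ) (x : Site d) (k : Fin d → ℝ) :
    Complex.exp (Complex.I * (kdot k x : ℂ)) * Complex.exp (-(t : ℂ) * (1 - latticeFT J k)) =
      Complex.exp (Complex.I * (kdot k x : ℂ)) * (Real.exp (-(t * (1 - (latticeFT J k).re))) : ℂ) := by
  rw [one_sub_latticeFT_eq_ofReal hJ hJe k, Complex.ofReal_exp]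
  push_cast; ring_nf

/-- `(2π)^d I_t(x) = ∫_{[-π,π]^d} e^{ik·x} e^{-t(1 - Re Ĵ(k))} dk` for an even kernel. [cite: Hara2008, (2.2)] -/
theorem two_pi_pow_mul_haraI {J : Site d → ℝ} (hJ : Summable fun x => |J x|) (hJe : ∀ x, J (-x) = J x)
    (t : ℝ) (x : Site d) :
    (2 * Real.pi : ℂ) ^ d * haraI J t x =
      ∫ k in cube d, Complex.exp (Complex.I * (kdot k x : ℂ)) * (Real.exp (-(t * (1 - (latticeFT J k).re))) : ℂ) := by
  rw [haraI, mul_div_cancel₀ _ (two_pi_pow_ne_zero d)]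
  exact integral_congr_ae (Filter.Eventually.of_forall fun k => haraI_integrand_eq hJ hJe t x k)

/-- `(2π)^d × ` the Gaussian main term is the Gaussian Fourier integral on `ℝ^d`:
`∫_{ℝ^d} e^{ik·x} e^{-tK₁|k|²/(2d)} dk = (2π)^d (d/(2πK₁t))^{d/2} e^{-d|x|²/(2tK₁)}`.
[cite: Hara2008, proof of Lemma 2.2, (2.19)–(2.20) and (2.25)] -/
theorem integral_gaussian_eq_two_pi_pow_mul_gaussMain (hd : 1 ≤ d) {K₁ t : ℝ} (hK : 0 < K₁) (ht : 0 < t)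
    (x : Site d) :
    ∫ k : Fin d → ℝ, Complex.exp (Complex.I * (kdot k x : ℂ)) *
        (Real.exp (-(t * K₁ / (2 * d)) * ∑ i, k i ^ 2) : ℂ) =
      (((2 * Real.pi) ^ d * gaussMain d K₁ t (euclidNorm x) : ℝ) : ℂ) := by
  have hd0 : (0 : ℝ) < d := by exact_mod_cast hd
  have hb : 0 < t * K₁ / (2 * d) := by positivity
  rw [integral_cexp_kdot_mul_exp_neg_mul_sum_sq hb x]
  congr 1
  unfold gaussMain
  have h1 : Real.pi / (t * K₁ / (2 * d)) = (2 * Real.pi) ^ (2 : ℝ) * ((d : ℝ) / (2 * Real.pi * K₁ * t)) := by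
    field_simp; norm_num; ring
  have h2 : euclidNorm x ^ 2 / (4 * (t * K₁ / (2 * d))) = (d : ℝ) * euclidNorm x ^ 2 / (2 * t * K₁) := by
    field_simp; ring
  rw [h1, h2, Real.mul_rpow (by positivity) (by positivity), ← Real.rpow_mul (by positivity),
    show (2 : ℝ) * ((d : ℝ) / 2) = d by ring, Real.rpow_natCast]
  ring


/-! ### Lemma 2.2 in the quantitative form: auxiliary computations -/

/-- The `t`-dependence of the inner error integral:
`t · Σ_j ∫ |k_j|^q e^{-ta₀|k|²} dk = d V₀ t^{-(d+q-2)/2}`, `V₀ = a₀^{-(q+1)/2}Γ((q+1)/2)(π/a₀)^{(d-1)/2}`.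
[cite: Hara2008, proof of Lemma 2.2 (the estimate of I_{t,3}) and §2.6] -/
theorem integral_inner_majorant (hd : 1 ≤ d) {a₀ q t : ℝ} (ha₀ : 0 < a₀) (hq : 0 ≤ q) (ht : 0 < t) :
    Integrable (fun k : Fin d → ℝ => ∑ j, |k j| ^ q * Real.exp (-(t * a₀) * ∑ i, k i ^ 2)) ∧
    t * ∫ k : Fin d → ℝ, ∑ j, |k j| ^ q * Real.exp (-(t * a₀) * ∑ i, k i ^ 2) =
      (d : ℝ) * (a₀ ^ (-(q + 1) / 2) * Real.Gamma ((q + 1) / 2) * (Real.pi / a₀) ^ (((d : ℝ) - 1) / 2)) *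
        t ^ (-(((d : ℝ) + q - 2) / 2)) := by
  have hta : 0 < t * a₀ := by positivity
  have hj := fun j : Fin d => integral_abs_apply_rpow_mul_exp_neg_mul_sum_sq hd hta hq j
  refine ⟨integrable_finsetSum _ fun j _ => (hj j).1, ?_⟩
  rw [integral_finsetSum _ (fun j _ => (hj j).1), Finset.sum_congr rfl fun j _ => (hj j).2,
    Finset.sum_const, Finset.card_univ, Fintype.card_fin, nsmul_eq_mul]
  have e1 : (t * a₀) ^ (-(q + 1) / 2) = t ^ (-(q + 1) / 2) * a₀ ^ (-(q + 1) / 2) :=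
    Real.mul_rpow ht.le ha₀.le
  have e2 : (Real.pi / (t * a₀)) ^ (((d : ℝ) - 1) / 2) =
      t ^ (-(((d : ℝ) - 1) / 2)) * (Real.pi / a₀) ^ (((d : ℝ) - 1) / 2) := by
    rw [show Real.pi / (t * a₀) = t⁻¹ * (Real.pi / a₀) by field_simp,
      Real.mul_rpow (inv_nonneg.2 ht.le) (by positivity), Real.inv_rpow ht.le, ← Real.rpow_neg ht.le]
  have e3 : t * (t ^ (-(q + 1) / 2) * t ^ (-(((d : ℝ) - 1) / 2))) = t ^ (-(((d : ℝ) + q - 2) / 2)) := by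
    have h1 := Real.rpow_add ht 1 (-(q + 1) / 2 + -(((d : ℝ) - 1) / 2))
    rw [Real.rpow_one] at h1
    rw [← Real.rpow_add ht, ← h1]
    congr 1; ring
  rw [e1, e2]
  calc t * ((d : ℝ) * (t ^ (-(q + 1) / 2) * a₀ ^ (-(q + 1) / 2) * Real.Gamma ((q + 1) / 2) *
        (t ^ (-(((d : ℝ) - 1) / 2)) * (Real.pi / a₀) ^ (((d : ℝ) - 1) / 2))))
      = (d : ℝ) * (a₀ ^ (-(q + 1) / 2) * Real.Gamma ((q + 1) / 2) * (Real.pi / a₀) ^ (((d : ℝ) - 1) / 2)) *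
          (t * (t ^ (-(q + 1) / 2) * t ^ (-(((d : ℝ) - 1) / 2)))) := by ring
    _ = _ := by rw [e3]

/-- The tail majorant integrates to `∫ e^{-(ta₀/2)κ²} e^{-(ta₀/2)|k|²} dk = e^{-(ta₀/2)κ²} (2π/a₀)^{d/2} t^{-d/2}`.
[cite: Hara2008, proof of Lemma 2.2, (2.24)–(2.25)] -/
theorem integral_tail_majorant {a₀ t : ℝ} (ha₀ : 0 < a₀) (ht : 0 < t) (κ : ℝ) :
    ∫ k : Fin d → ℝ, Real.exp (-(t * a₀ / 2 * κ ^ 2)) * Real.exp (-(t * a₀ / 2) * ∑ i, k i ^ 2) =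
      Real.exp (-(t * a₀ / 2 * κ ^ 2)) * (2 * Real.pi / a₀) ^ ((d : ℝ) / 2) * t ^ (-((d : ℝ) / 2)) := by
  have hta2 : 0 < t * a₀ / 2 := by positivity
  rw [integral_const_mul, integral_exp_neg_mul_sum_sq hta2, mul_assoc]
  congr 1
  rw [show Real.pi / (t * a₀ / 2) = t⁻¹ * (2 * Real.pi / a₀) by field_simp,
    Real.mul_rpow (inv_nonneg.2 ht.le) (by positivity), Real.inv_rpow ht.le, ← Real.rpow_neg ht.le]
  ring

/-- The tail constant: with `κ = t^{-1/(2+ρ')}`, `e^{-(a₀/2) tκ²} ≤ C' t^{-ρ'/2}` for `t > 0`, where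
`C' = (2/a₀)^β (β/e)^β`, `β = (2+ρ')/2` (`tκ² = t^{ρ'/(2+ρ')}` and `s^βe^{-s} ≤ (β/e)^β`).
[cite: Hara2008, proof of Lemma 2.2 ((2.25)) and §2.6] -/
theorem exp_neg_cutoff_le {a₀ ρ' t : ℝ} (ha₀ : 0 < a₀) (hρ' : 0 < ρ') (ht : 0 < t) :
    Real.exp (-(t * a₀ / 2 * (t ^ (-(1 / (2 + ρ')))) ^ 2)) ≤
      ((2 / a₀) ^ ((2 + ρ') / 2) * (((2 + ρ') / 2) / Real.exp 1) ^ ((2 + ρ') / 2)) * t ^ (-(ρ' / 2)) := by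
  set κ : ℝ := t ^ (-(1 / (2 + ρ'))) with hκ
  set γ' : ℝ := ρ' / (2 + ρ') with hγ'
  set β : ℝ := (2 + ρ') / 2 with hβ
  have hβ0 : 0 < β := by positivity
  have h2ρ : 0 < 2 + ρ' := by linarith
  have htκ : t * κ ^ 2 = t ^ γ' := by
    rw [hκ, ← Real.rpow_natCast, ← Real.rpow_mul ht.le, ← Real.rpow_one_add' ht.le, hγ']
    · congr 1; push_cast; field_simp; ring
    · push_cast
      rw [show (1 : ℝ) + -(1 / (2 + ρ')) * 2 = ρ' / (2 + ρ') by field_simp; ring]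
      positivity
  set u : ℝ := a₀ / 2 * t ^ γ' with hu
  have hu0 : 0 < u := by positivity
  have heu : Real.exp (-(t * a₀ / 2 * κ ^ 2)) = Real.exp (-u) := by
    congr 1; rw [hu, show t * a₀ / 2 * κ ^ 2 = a₀ / 2 * (t * κ ^ 2) by ring, htκ]
  have hkey := rpow_mul_exp_neg_le hu0 hβ0
  have htβ : t ^ (ρ' / 2) = (2 / a₀) ^ β * u ^ β := by
    rw [← Real.mul_rpow (by positivity) hu0.le, show 2 / a₀ * u = t ^ γ' by rw [hu]; field_simp,
      ← Real.rpow_mul ht.le]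
    congr 1; rw [hγ', hβ]; field_simp
  have hpos : 0 < t ^ (ρ' / 2) := Real.rpow_pos_of_pos ht _
  rw [heu, Real.rpow_neg ht.le, ← div_eq_mul_inv, le_div_iff₀ hpos, htβ]
  calc Real.exp (-u) * ((2 / a₀) ^ β * u ^ β) = (2 / a₀) ^ β * (u ^ β * Real.exp (-u)) := by ring
    _ ≤ (2 / a₀) ^ β * (β / Real.exp 1) ^ β := mul_le_mul_of_nonneg_left hkey (by positivity)

/-! ### Lemma 2.2 in the quantitative form: the three pieces -/

/-- The integrand of `(2π)^d I_t(x)` for an even kernel, written with the real exponent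
`w(k) = 1 - Re Ĵ(k)`. [cite: Hara2008, (2.2)] -/
def lem22Phi (J : Site d → ℝ) (t : ℝ) (x : Site d) (k : Fin d → ℝ) : ℂ :=
  Complex.exp (Complex.I * (kdot k x : ℂ)) * (Real.exp (-(t * (1 - (latticeFT J k).re))) : ℂ)

/-- The Gaussian comparison integrand `e^{ik·x} e^{-tb|k|²}` (`b = K₁/(2d)`).
[cite: Hara2008, proof of Lemma 2.2, (2.19)] -/
def lem22Psi (b t : ℝ) (x : Site d) (k : Fin d → ℝ) : ℂ :=
  Complex.exp (Complex.I * (kdot k x : ℂ)) * (Real.exp (-(t * b) * ∑ i, k i ^ 2) : ℂ)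

/-- `‖Φ(k)‖ = e^{-t w(k)}`. [folklore] -/
theorem norm_lem22Phi (J : Site d → ℝ) (t : ℝ) (x : Site d) (k : Fin d → ℝ) :
    ‖lem22Phi J t x k‖ = Real.exp (-(t * (1 - (latticeFT J k).re))) := by
  rw [lem22Phi, norm_mul, norm_cexp_I_mul_kdot, one_mul, Complex.norm_real, Real.norm_eq_abs,
    abs_of_pos (Real.exp_pos _)]

/-- `‖Ψ(k)‖ = e^{-tb|k|²}`. [folklore] -/
theorem norm_lem22Psi (b t : ℝ) (x : Site d) (k : Fin d → ℝ) :
    ‖lem22Psi b t x k‖ = Real.exp (-(t * b) * ∑ i, k i ^ 2) := by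
  rw [lem22Psi, norm_mul, norm_cexp_I_mul_kdot, one_mul, Complex.norm_real, Real.norm_eq_abs,
    abs_of_pos (Real.exp_pos _)]

/-- `Φ` is integrable on the cube when `1 - Re Ĵ ≥ 0` there (`t ≥ 0`). [folklore] -/
theorem integrableOn_lem22Phi {J : Site d → ℝ} (hJ : Summable fun x => |J x|)
    (hw : ∀ k ∈ cube d, 0 ≤ 1 - (latticeFT J k).re) {t : ℝ} (ht : 0 ≤ t) (x : Site d) :
    IntegrableOn (lem22Phi J t x) (cube d) := by
  refine Measure.integrableOn_of_bounded (M := 1) (volume_cube_lt_top d).ne ?_ ?_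
  · have hc : Continuous fun k : Fin d → ℝ => 1 - (latticeFT J k).re :=
      continuous_const.sub (Complex.continuous_re.comp (continuous_latticeFT hJ))
    exact ((continuous_cexp_I_mul_kdot x).mul (Complex.continuous_ofReal.comp
      (Real.continuous_exp.comp ((continuous_const.mul hc).neg)))).aestronglyMeasurable
  · refine (ae_restrict_iff' (measurableSet_cube d)).2 (Filter.Eventually.of_forall fun k hk => ?_)
    rw [norm_lem22Phi, Real.exp_le_one_iff, neg_nonpos]
    exact mul_nonneg ht (hw k hk)

/-- `Ψ` is integrable on `ℝ^d` (`tb > 0`). [folklore] -/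
theorem integrable_lem22Psi {b t : ℝ} (hb : 0 < t * b) (x : Site d) : Integrable (lem22Psi b t x) := by
  have h1 : Integrable (fun k : Fin d → ℝ => (Real.exp (-(t * b) * ∑ i, k i ^ 2) : ℂ)) :=
    (integrable_exp_neg_mul_sum_sq hb).ofReal
  exact h1.bdd_mul (continuous_cexp_I_mul_kdot x).aestronglyMeasurable
    (Filter.Eventually.of_forall fun k => (norm_cexp_I_mul_kdot k x).le)

/-- **The inner region** (`I_{t,3}`): if `a₀|k|² ≤ 1 - Re Ĵ(k)` on the cube,
`|1 - Re Ĵ(k) - b|k|²| ≤ C_R |k|^{q}` for all `k` (`q = 2+ρ' ≥ 2`), `0 < a₀ ≤ b`, then for `t > 0` and a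
measurable `B ⊆ [-π,π]^d`, `‖∫_B (Φ - Ψ)‖ ≤ C_R d^{q/2-1} (d V₀) t^{-(d+q-2)/2}` — pointwise
`|e^{-tw} - e^{-tb|k|²}| ≤ t|w - b|k|²| e^{-ta₀|k|²} ≤ t C_R d^{q/2-1} Σ_j|k_j|^q e^{-ta₀|k|²}` and the
product Gaussian moments. [cite: Hara2008, proof of Lemma 2.2 ((2.20)–(2.22)) and §2.6] -/
theorem lem22_inner_bound (hd : 1 ≤ d) {J : Site d → ℝ} {a₀ b CR q t : ℝ}
    (hlow : ∀ k ∈ cube d, a₀ * ∑ i, k i ^ 2 ≤ 1 - (latticeFT J k).re)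
    (hR : ∀ k : Fin d → ℝ, |1 - (latticeFT J k).re - b * ∑ i, k i ^ 2| ≤ CR * knorm k ^ q)
    (hCR : 0 ≤ CR) (ha₀ : 0 < a₀) (hab : a₀ ≤ b) (hq : 2 ≤ q) (ht : 0 < t) (x : Site d)
    {B : Set (Fin d → ℝ)} (hBm : MeasurableSet B) (hBc : B ⊆ cube d) :
    ‖∫ k in B, (lem22Phi J t x k - lem22Psi b t x k)‖ ≤
      CR * (d : ℝ) ^ (q / 2 - 1) *
        ((d : ℝ) * (a₀ ^ (-(q + 1) / 2) * Real.Gamma ((q + 1) / 2) * (Real.pi / a₀) ^ (((d : ℝ) - 1) / 2))) *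
        t ^ (-(((d : ℝ) + q - 2) / 2)) := by
  have hq0 : 0 ≤ q := by linarith
  obtain ⟨hh_int, hh_val⟩ := integral_inner_majorant hd ha₀ hq0 ht
  set h₁ : (Fin d → ℝ) → ℝ := fun k => t * CR * (d : ℝ) ^ (q / 2 - 1) *
    ∑ j, |k j| ^ q * Real.exp (-(t * a₀) * ∑ i, k i ^ 2) with hh₁
  have hh₁_int : Integrable h₁ := hh_int.const_mul _
  have hh₁_nn : ∀ k, 0 ≤ h₁ k := fun k => by
    simp only [hh₁]
    refine mul_nonneg (by positivity) (Finset.sum_nonneg fun j _ => ?_)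
    exact mul_nonneg (Real.rpow_nonneg (abs_nonneg _) _) (Real.exp_pos _).le
  have hpt : ∀ k ∈ cube d, ‖lem22Phi J t x k - lem22Psi b t x k‖ ≤ h₁ k := by
    intro k hk
    set S := ∑ i, k i ^ 2 with hS
    set w := 1 - (latticeFT J k).re with hw
    have hS0 : 0 ≤ S := Finset.sum_nonneg fun i _ => sq_nonneg _
    have hdiff : ‖lem22Phi J t x k - lem22Psi b t x k‖ = |Real.exp (-(t * w)) - Real.exp (-(t * b * S))| := by
      rw [lem22Phi, lem22Psi, ← mul_sub, norm_mul, norm_cexp_I_mul_kdot, one_mul, ← Complex.ofReal_sub,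
        Complex.norm_real, Real.norm_eq_abs]
      congr 2; congr 2; ring
    rw [hdiff]
    have hm1 : t * a₀ * S ≤ t * w := by
      have := hlow k hk; rw [← hS, ← hw] at this; nlinarith
    have hm2 : t * a₀ * S ≤ t * b * S := by
      have : a₀ * S ≤ b * S := mul_le_mul_of_nonneg_right hab hS0
      nlinarith
    have hmv := abs_exp_neg_sub_exp_neg_le hm1 hm2
    have hRk : |t * w - t * b * S| ≤ t * (CR * ((d : ℝ) ^ (q / 2 - 1) * ∑ j, |k j| ^ q)) := by
      rw [show t * w - t * b * S = t * (w - b * S) by ring, abs_mul, abs_of_pos ht]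
      refine mul_le_mul_of_nonneg_left ((hR k).trans (mul_le_mul_of_nonneg_left ?_ hCR)) ht.le
      have hk1 : knorm k ^ q = S ^ (q / 2) := by
        rw [knorm, Real.sqrt_eq_rpow, ← Real.rpow_mul hS0]; congr 1; ring
      have hpm := sum_sq_rpow_le hd (by linarith : (1 : ℝ) ≤ q / 2) k
      rw [← hS, show 2 * (q / 2) = q by ring] at hpm
      rw [hk1]; exact hpm
    have hE : Real.exp (-(t * a₀ * S)) = Real.exp (-(t * a₀) * ∑ i, k i ^ 2) := by rw [hS]; ring_nf
    calc |Real.exp (-(t * w)) - Real.exp (-(t * b * S))|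
        ≤ |t * w - t * b * S| * Real.exp (-(t * a₀ * S)) := hmv
      _ ≤ t * (CR * ((d : ℝ) ^ (q / 2 - 1) * ∑ j, |k j| ^ q)) * Real.exp (-(t * a₀ * S)) :=
          mul_le_mul_of_nonneg_right hRk (Real.exp_pos _).le
      _ = h₁ k := by rw [hE]; simp only [hh₁]; rw [← Finset.sum_mul]; ring
  have h1 : ‖∫ k in B, (lem22Phi J t x k - lem22Psi b t x k)‖ ≤ ∫ k in B, h₁ k :=
    norm_integral_le_of_norm_le hh₁_int.integrableOn
      ((ae_restrict_iff' hBm).2 (Filter.Eventually.of_forall fun k hk => hpt k (hBc hk)))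
  have h2 : ∫ k in B, h₁ k ≤ ∫ k, h₁ k := setIntegral_le_integral hh₁_int (Filter.Eventually.of_forall hh₁_nn)
  refine h1.trans (h2.trans (le_of_eq ?_))
  simp only [hh₁]
  rw [integral_const_mul, show t * CR * (d : ℝ) ^ (q / 2 - 1) *
      ∫ k : Fin d → ℝ, ∑ j, |k j| ^ q * Real.exp (-(t * a₀) * ∑ i, k i ^ 2) =
      CR * (d : ℝ) ^ (q / 2 - 1) * (t * ∫ k : Fin d → ℝ, ∑ j, |k j| ^ q * Real.exp (-(t * a₀) * ∑ i, k i ^ 2))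
      by ring, hh_val]
  ring

/-- **The tails** (`I_{t,2}`, `I_{t,4}`): for a measurable `F` with `‖F(k)‖ ≤ e^{-ta₀|k|²}` on a
measurable set `S` disjoint from the ball `{Σk_i² ≤ κ²}`,
`‖∫_S F‖ ≤ e^{-(ta₀/2)κ²} (2π/a₀)^{d/2} t^{-d/2}`. [cite: Hara2008, proof of Lemma 2.2, (2.22)–(2.25)] -/
theorem lem22_tail_bound {a₀ t : ℝ} (ha₀ : 0 < a₀) (ht : 0 < t) (κ : ℝ) {F : (Fin d → ℝ) → ℂ}
    {S : Set (Fin d → ℝ)} (hS : MeasurableSet S) (hSκ : ∀ k ∈ S, κ ^ 2 < ∑ i, k i ^ 2)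
    (hF : ∀ k ∈ S, ‖F k‖ ≤ Real.exp (-(t * a₀ * ∑ i, k i ^ 2))) :
    ‖∫ k in S, F k‖ ≤ Real.exp (-(t * a₀ / 2 * κ ^ 2)) * (2 * Real.pi / a₀) ^ ((d : ℝ) / 2) * t ^ (-((d : ℝ) / 2)) := by
  set g₂ : (Fin d → ℝ) → ℝ := fun k => Real.exp (-(t * a₀ / 2 * κ ^ 2)) *
    Real.exp (-(t * a₀ / 2) * ∑ i, k i ^ 2) with hg₂
  have hta2 : 0 < t * a₀ / 2 := by positivity
  have hg₂_int : Integrable g₂ := (integrable_exp_neg_mul_sum_sq hta2).const_mul _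
  have hg₂_nn : ∀ k, 0 ≤ g₂ k := fun k => by simp only [hg₂]; positivity
  have hpt : ∀ k ∈ S, ‖F k‖ ≤ g₂ k := by
    intro k hk
    refine (hF k hk).trans ?_
    simp only [hg₂]
    rw [← Real.exp_add]
    refine Real.exp_le_exp.2 ?_
    nlinarith [hSκ k hk, hta2]
  have h1 : ‖∫ k in S, F k‖ ≤ ∫ k in S, g₂ k :=
    norm_integral_le_of_norm_le hg₂_int.integrableOn ((ae_restrict_iff' hS).2 (Filter.Eventually.of_forall hpt))
  refine h1.trans ((setIntegral_le_integral hg₂_int (Filter.Eventually.of_forall hg₂_nn)).trans (le_of_eq ?_))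
  exact integral_tail_majorant ha₀ ht κ

/-! ### Lemma 2.2 in the quantitative form: the proof -/

/-- **Hara 2008, Lemma 2.2 with the error bound of §2.6, proved** (`Hara2008_lem22`): for `t ≥ 1`
and all `x`, `|I_t(x) - (d/(2πK₁t))^{d/2}e^{-d|x|²/(2tK₁)}| ≤ c t^{-(d+ρ∧2)/2}`. The printed proof
with `k_t = t^{-1/(2+ρ')}`, `ρ' = ρ∧2`: `(2π)^d I_t(x) - ∫_{ℝ^d} e^{ikx - tK₁|k|²/(2d)} =
∫_{|k|≤k_t} e^{ikx}(e^{-t(1-Ĵ)} - e^{-tK₁|k|²/(2d)}) + ∫_{cube, |k|>k_t} e^{ikx}e^{-t(1-Ĵ)} -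
∫_{|k|>k_t} e^{ikx-tK₁|k|²/(2d)}` (`I_{t,3}`, `I_{t,4}`, `I_{t,2}`); the first is at most
`t|R̂₂(k)|e^{-tK₀|k|²/(2d)}` pointwise (`|R̂₂(k)| ≤ C|k|^{2+ρ'}`, `K₀ ≤ K₁`), which integrates over
`ℝ^d` to `O(t^{-(d+ρ')/2})` (power-mean bound and product Gaussian moments); the two tails are at
most `e^{-tK₀k_t²/(4d)} ∫ e^{-tK₀|k|²/(4d)} = (4πd/(tK₀))^{d/2} e^{-(K₀/4d) t^{ρ'/(2+ρ')}}`, and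
`e^{-c t^{γ}} t^{ρ'/2}` is bounded (`s^βe^{-s} ≤ (β/e)^β`).
[cite: Hara2008, Lemma 2.2 and its proof ((2.19)–(2.25)), §2.6] -/
theorem Hara2008_lem22_holds : Hara2008_lem22 := by
  intro d hd J ρ hK
  -- data
  have hd1 : 1 ≤ d := by omega
  have hd0 : (0 : ℝ) < d := by exact_mod_cast (show 0 < d by omega)
  have hJabs : Summable fun x => |J x| := hK.hasSum_one.summable.abs
  have hJe : ∀ x, J (-x) = J x := IsZdSymmetric.neg hK.symm
  obtain ⟨K₀, hK₀, hlow⟩ := hK.lower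
  set K₁ : ℝ := ∑' y, euclidNorm y ^ 2 * J y with hK₁
  have hK₁0 : 0 < K₁ := hK.secondMoment_pos
  have hK01 : K₀ ≤ K₁ := hK.K0_le_K1 hd1 hlow
  set ρ' : ℝ := min ρ 2 with hρ'
  have hρ'0 : 0 < ρ' := lt_min hK.rho_pos two_pos
  have hρ'2 : ρ' ≤ 2 := min_le_right _ _
  have hθs := summable_rpow_mul_abs_of_le hρ'0.le (min_le_left ρ 2) hK.summable_rho
  set M : ℝ := ∑' x, euclidNorm x ^ (2 + ρ') * |J x| with hM
  set a₀ : ℝ := K₀ / (2 * d) with ha₀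
  set b : ℝ := K₁ / (2 * d) with hb
  have ha₀0 : 0 < a₀ := by positivity
  have hb0 : 0 < b := by positivity
  have hab : a₀ ≤ b := by rw [ha₀, hb]; exact div_le_div_of_nonneg_right hK01 (by positivity)
  have hlow' : ∀ k ∈ cube d, a₀ * ∑ i, k i ^ 2 ≤ 1 - (latticeFT J k).re := fun k hk => by
    have h := hlow k hk
    have e : a₀ * ∑ i, k i ^ 2 = K₀ * (∑ i, k i ^ 2) / (2 * d) := by rw [ha₀]; ring
    rw [e]; exact h
  have hw_nn : ∀ k ∈ cube d, 0 ≤ 1 - (latticeFT J k).re := fun k hk =>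
    le_trans (mul_nonneg ha₀0.le (Finset.sum_nonneg fun i _ => sq_nonneg (k i))) (hlow' k hk)
  have hR : ∀ k : Fin d → ℝ, |1 - (latticeFT J k).re - b * ∑ i, k i ^ 2| ≤ 5 / 2 * M * knorm k ^ (2 + ρ') := by
    intro k
    have h := abs_one_sub_re_latticeFT_sub_le hK.symm hK.hasSum_one hK.summable_sq hρ'0.le hρ'2 hθs k
    have e : b * ∑ i, k i ^ 2 = K₁ * (∑ i, k i ^ 2) / (2 * d) := by rw [hb]; ring
    rw [e]; exact h
  -- constants
  set q : ℝ := 2 + ρ' with hq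
  have hq2 : 2 ≤ q := by linarith
  set V : ℝ := (d : ℝ) * (a₀ ^ (-(q + 1) / 2) * Real.Gamma ((q + 1) / 2) * (Real.pi / a₀) ^ (((d : ℝ) - 1) / 2)) with hV
  set C₁ : ℝ := 5 / 2 * M * (d : ℝ) ^ (q / 2 - 1) * V with hC₁
  set C' : ℝ := (2 / a₀) ^ ((2 + ρ') / 2) * (((2 + ρ') / 2) / Real.exp 1) ^ ((2 + ρ') / 2) with hC'
  have hC'0 : 0 ≤ C' := by positivity
  set C₂ : ℝ := 2 * (2 * Real.pi / a₀) ^ ((d : ℝ) / 2) * C' with hC₂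
  refine ⟨(C₁ + C₂) / (2 * Real.pi) ^ d, fun t ht x => ?_⟩
  have ht0 : 0 < t := by linarith
  -- the cutoff and the ball
  set κ : ℝ := t ^ (-(1 / (2 + ρ'))) with hκ
  have hκ0 : 0 < κ := Real.rpow_pos_of_pos ht0 _
  have hκ1 : κ ≤ 1 := Real.rpow_le_one_of_one_le_of_nonpos ht (by rw [neg_nonpos]; positivity)
  set B : Set (Fin d → ℝ) := {k | ∑ i, k i ^ 2 ≤ κ ^ 2} with hB
  have hsum_cont : Continuous fun k : Fin d → ℝ => ∑ i, k i ^ 2 := by fun_prop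
  have hBm : MeasurableSet B := measurableSet_le hsum_cont.measurable measurable_const
  have hBc : B ⊆ cube d := fun k hk => mem_cube_of_sum_sq_le hκ0.le hκ1 hk
  have hcube : MeasurableSet (cube d) := measurableSet_cube d
  have hnotB : ∀ k, k ∉ B → κ ^ 2 < ∑ i, k i ^ 2 := fun k hk => by
    simp only [hB, Set.mem_setOf_eq, not_le] at hk; exact hk
  -- the integrands and their integrals
  have hI : (2 * Real.pi : ℂ) ^ d * haraI J t x = ∫ k in cube d, lem22Phi J t x k :=
    two_pi_pow_mul_haraI hJabs hJe t x
  have htb : 0 < t * b := by positivity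
  have hG : ∫ k, lem22Psi b t x k = (((2 * Real.pi) ^ d * gaussMain d K₁ t (euclidNorm x) : ℝ) : ℂ) := by
    have h := integral_gaussian_eq_two_pi_pow_mul_gaussMain hd1 hK₁0 ht0 x
    rw [← h]
    refine integral_congr_ae (Filter.Eventually.of_forall fun k => ?_)
    simp only [lem22Psi, hb]
    congr 3; ring
  have hΦ_int : IntegrableOn (lem22Phi J t x) (cube d) := integrableOn_lem22Phi hJabs hw_nn ht0.le x
  have hΨ_int : Integrable (lem22Psi b t x) := integrable_lem22Psi htb x
  -- (i)
  have hE₁ : ‖∫ k in B, (lem22Phi J t x k - lem22Psi b t x k)‖ ≤ C₁ * t ^ (-(((d : ℝ) + ρ') / 2)) := by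
    have hM0 : 0 ≤ M := tsum_nonneg fun x => mul_nonneg (Real.rpow_nonneg (euclidNorm_nonneg x) _) (abs_nonneg _)
    have h := lem22_inner_bound hd1 hlow' hR (by positivity) ha₀0 hab hq2 ht0 x hBm hBc
    rw [show (d : ℝ) + q - 2 = (d : ℝ) + ρ' by rw [hq]; ring] at h
    simpa only [hC₁, hV, mul_assoc] using h
  -- (ii)
  have hE₂ : ‖∫ k in cube d \ B, lem22Phi J t x k‖ ≤
      Real.exp (-(t * a₀ / 2 * κ ^ 2)) * (2 * Real.pi / a₀) ^ ((d : ℝ) / 2) * t ^ (-((d : ℝ) / 2)) := by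
    refine lem22_tail_bound ha₀0 ht0 κ (hcube.diff hBm) (fun k hk => hnotB k hk.2) fun k hk => ?_
    rw [norm_lem22Phi]
    refine Real.exp_le_exp.2 ?_
    have := hlow' k hk.1
    nlinarith
  -- (iii)
  have hE₃ : ‖∫ k in Bᶜ, lem22Psi b t x k‖ ≤
      Real.exp (-(t * a₀ / 2 * κ ^ 2)) * (2 * Real.pi / a₀) ^ ((d : ℝ) / 2) * t ^ (-((d : ℝ) / 2)) := by
    refine lem22_tail_bound ha₀0 ht0 κ hBm.compl (fun k hk => hnotB k hk) fun k _ => ?_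
    rw [norm_lem22Psi]
    refine Real.exp_le_exp.2 ?_
    have hS0 : 0 ≤ ∑ i, k i ^ 2 := Finset.sum_nonneg fun i _ => sq_nonneg _
    have : a₀ * ∑ i, k i ^ 2 ≤ b * ∑ i, k i ^ 2 := mul_le_mul_of_nonneg_right hab hS0
    nlinarith
  have htail : Real.exp (-(t * a₀ / 2 * κ ^ 2)) ≤ C' * t ^ (-(ρ' / 2)) := exp_neg_cutoff_le ha₀0 hρ'0 ht0
  have hE₂₃ : Real.exp (-(t * a₀ / 2 * κ ^ 2)) * (2 * Real.pi / a₀) ^ ((d : ℝ) / 2) * t ^ (-((d : ℝ) / 2)) +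
      Real.exp (-(t * a₀ / 2 * κ ^ 2)) * (2 * Real.pi / a₀) ^ ((d : ℝ) / 2) * t ^ (-((d : ℝ) / 2)) ≤
      C₂ * t ^ (-(((d : ℝ) + ρ') / 2)) := by
    rw [hC₂]
    have hsplit : t ^ (-(((d : ℝ) + ρ') / 2)) = t ^ (-((d : ℝ) / 2)) * t ^ (-(ρ' / 2)) := by
      rw [← Real.rpow_add ht0]; congr 1; ring
    rw [hsplit]
    calc Real.exp (-(t * a₀ / 2 * κ ^ 2)) * (2 * Real.pi / a₀) ^ ((d : ℝ) / 2) * t ^ (-((d : ℝ) / 2)) +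
          Real.exp (-(t * a₀ / 2 * κ ^ 2)) * (2 * Real.pi / a₀) ^ ((d : ℝ) / 2) * t ^ (-((d : ℝ) / 2))
        = 2 * ((2 * Real.pi / a₀) ^ ((d : ℝ) / 2) * t ^ (-((d : ℝ) / 2))) * Real.exp (-(t * a₀ / 2 * κ ^ 2)) := by
          ring
      _ ≤ 2 * ((2 * Real.pi / a₀) ^ ((d : ℝ) / 2) * t ^ (-((d : ℝ) / 2))) * (C' * t ^ (-(ρ' / 2))) :=
          mul_le_mul_of_nonneg_left htail (by positivity)
      _ = _ := by ring
  -- the decomposition and the conclusion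
  have hdecomp : (∫ k in cube d, lem22Phi J t x k) - ∫ k, lem22Psi b t x k =
      (∫ k in B, (lem22Phi J t x k - lem22Psi b t x k)) + (∫ k in cube d \ B, lem22Phi J t x k) -
        ∫ k in Bᶜ, lem22Psi b t x k := by
    rw [setIntegral_sdiff hBm hΦ_int hBc, ← integral_add_compl hBm hΨ_int,
      integral_sub (hΦ_int.mono_set hBc) hΨ_int.integrableOn]
    ring
  have hpi : (0 : ℝ) < (2 * Real.pi) ^ d := by positivity
  have hmain : ‖(2 * Real.pi : ℂ) ^ d * (haraI J t x - (gaussMain d K₁ t (euclidNorm x) : ℂ))‖ ≤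
      (C₁ + C₂) * t ^ (-(((d : ℝ) + ρ') / 2)) := by
    have heq : (2 * Real.pi : ℂ) ^ d * (haraI J t x - (gaussMain d K₁ t (euclidNorm x) : ℂ)) =
        (∫ k in cube d, lem22Phi J t x k) - ∫ k, lem22Psi b t x k := by
      rw [mul_sub, hI, hG]; push_cast; ring
    rw [heq, hdecomp]
    calc ‖(∫ k in B, (lem22Phi J t x k - lem22Psi b t x k)) + (∫ k in cube d \ B, lem22Phi J t x k) -
          ∫ k in Bᶜ, lem22Psi b t x k‖
        ≤ ‖∫ k in B, (lem22Phi J t x k - lem22Psi b t x k)‖ + ‖∫ k in cube d \ B, lem22Phi J t x k‖ +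
            ‖∫ k in Bᶜ, lem22Psi b t x k‖ :=
          (norm_sub_le _ _).trans (add_le_add (norm_add_le _ _) le_rfl)
      _ ≤ C₁ * t ^ (-(((d : ℝ) + ρ') / 2)) +
            Real.exp (-(t * a₀ / 2 * κ ^ 2)) * (2 * Real.pi / a₀) ^ ((d : ℝ) / 2) * t ^ (-((d : ℝ) / 2)) +
            Real.exp (-(t * a₀ / 2 * κ ^ 2)) * (2 * Real.pi / a₀) ^ ((d : ℝ) / 2) * t ^ (-((d : ℝ) / 2)) :=
          add_le_add (add_le_add hE₁ hE₂) hE₃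
      _ ≤ C₁ * t ^ (-(((d : ℝ) + ρ') / 2)) + C₂ * t ^ (-(((d : ℝ) + ρ') / 2)) := by
          rw [add_assoc]; exact add_le_add le_rfl hE₂₃
      _ = _ := by ring
  have hnorm2π : ‖(2 * Real.pi : ℂ) ^ d‖ = (2 * Real.pi) ^ d := by
    rw [norm_pow, show (2 * Real.pi : ℂ) = ((2 * Real.pi : ℝ) : ℂ) by push_cast; ring, Complex.norm_real,
      Real.norm_eq_abs, abs_of_pos (by positivity)]
  rw [norm_mul, hnorm2π] at hmain
  rw [div_mul_eq_mul_div, le_div_iff₀ hpi, mul_comm]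
  exact hmain

end Literature.Barriers.CriticalPhenomena
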